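import Literature.IUT.HodgeTheaters.GoodLocalFrobenioidOfGaloisUnitTransport
import Literature.AlgebraicGeometry.Frobenioids.PadicFrobenioidPairIsoOrientation
import HarnessLib

/-!
# [IUTchI] Example 3.3 (iii) (e) over the REAL bases: the unit transport of `Ψ` glued on `O^▷_{K̄_v}`

Mochizuki, *Inter-universal Teichmüller theory I*, kurims manuscript (May 2020), Example 3.3 (iii) (e), p. 79
[claim: Mochizuki2012, status: disputed] ("one may reconstruct the split Frobenioids `F⊢_v`, `F^Θ_v` category-theoretically
from `F̲_v`", l. 60–62; print's PRECEDING sentence, l. 52–53, supplies the input «the Kummer map of [AbsTopIII], Proposition 3.2,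
(iii)») — nothing of the series is asserted; no side is taken on [IUTchIII] Cor. 3.12.  Mochizuki, *The geometry of Frobenioids II*,
Kyushu J. Math. **62** (2008) [page/line locators: kurims manuscript, the cell's render of record], proof of Thm. 2.4 (ii), ms p. 21 l. 4
("`Ψ` induces a pair of compatible isomorphisms `G₁ ⥲ G₂`; `K̄₁^× ⥲ K̄₂^×`") [cite: MochizukiFrdII2008, proof of Thm 2.4 (ii) ms p.21].

PROOF-ONLY file (abc-iut cell, seat abc-iut-L5-t16 gen 7; row E33iii/e «hfix at the genuine datum», piece (F3b)), no
definitions, no new `Prop`.  Sequel of `GoodLocalFrobenioidOfGaloisUnitTransport.lean` (same hypotheses): the level-`k`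
readings of the unit transport of a self-equivalence `Ψ` of the REAL `C_v` are GLUED along the Galois tower into ONE
multiplicative map `C₁ : O^▷_{K̄_v} → O^▷_{K̄_v}` (`exists_unitTransport`): injective, `φ`-SEMILINEAR
(`C₁(aug(g)·x) = aug(φ g)·C₁(x)`), carrying units to units and only units, with `v(C₁(p)) = v(p)`, and LINKED to `Ψ`: for
every `w ∈ O^▷(X)` the rational function of `Ψ w` is `p^m` iff `C₁` of the rational function of `w` is `p^m`.  This is the
Frobenioid-side input (E1) of clause (e) in the form consumed, together with the anabelian input (E2) and the Kummer
rigidity (E3) (abc-iut-w4-d014, `Literature/NumberTheory/LocalFields/EquivariantUnitRigidity*.lean`), by the assembly.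
Valuation bookkeeping moved here from the prequel: `valuation_alg_eq_one_iff`, `valuation_reading_eq_one_iff`,
`valuation_reading_of_resK_eq_primeUnit`.
-/

noncomputable section

namespace Literature.IUT.HodgeTheaters

namespace GoodLocalFrobenioid

namespace UnitTransport

open CategoryTheory Opposite Function ValuativeRel Topology Filter Literature.AnabelianGeometry.SemiGraphs
open Literature.AlgebraicGeometry.Frobenioids Literature.AlgebraicGeometry.Frobenioids.PadicFrd
open Literature.AlgebraicGeometry.Frobenioids.BaseGaloisSystem

universe u

section Tower

variable {p : ℕ} [Fact p.Prime] (d : GaloisValDatum.{u} p) {P : Type u} [Group P] [TopologicalSpace P]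
  (aug : P →* d.Gal) (Q : Datum (CosetCat P) p)
  -- reading the fields of the base in `Ω = K̄_v`
  (ε : ∀ A : CosetCat P, Q.fld A →+* d.Ω) (hεi : ∀ A, Injective (ε A))
  (hε : ∀ ⦃A B : CosetCat P⦄ (f : A ⟶ B) (g : P), CosetCat.pt f = ((g : P) : B.carrier) →
    ∀ y : Q.fld B, ε A ((Q.base.map f).alg y) = (aug g) (ε B y))
  -- the self-equivalence and its [FrdI] Cor. 4.11 (iv) base data
  (Ψ : Q.frobenioid ≌ Q.frobenioid) (ΨBase : CosetCat P ⥤ CosetCat P)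
  (η : Ψ.functor ⋙ (ModelFrobenioid.data Q.Φ Q.B Q.divB).base ≅ (ModelFrobenioid.data Q.Φ Q.B Q.divB).base ⋙ ΨBase)
  (hdeg : ∀ ⦃X Y : Q.frobenioid⦄ (φ : X ⟶ Y), ModelFrobenioid.degFr (Ψ.functor.map φ) = ModelFrobenioid.degFr φ)
  (e : ∀ X : Q.frobenioid, ΨBase.obj X.base ⟶ (Ψ.functor.obj X).base)
  (he : ∀ ⦃Z Y : Q.frobenioid⦄ (lam : Z ⟶ Y),
    ΨBase.map (ModelFrobenioid.baseMap lam) ≫ e Y = e Z ≫ ModelFrobenioid.baseMap (Ψ.functor.map lam))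
  -- the straightening of `Ψ^Base` along a Galois tower
  (N N₂ : ℕ → OpenNormalSubgroup P) (hN : Antitone N) (hN₂ : Antitone N₂)
  (j : ∀ k, cQ (N₂ k) ⟶ ΨBase.obj (cQ (N k)))
  (hj : ∀ ⦃k k' : ℕ⦄ (h : k ≤ k'), j k' ≫ ΨBase.map (cproj (hN h)) = cproj (hN₂ h) ≫ j k)
  (φ : P → P) (hφ : ∀ (k : ℕ) (g : P), crightMul (N₂ k) (φ g) ≫ j k = j k ≫ ΨBase.map (crightMul (N k) g))

/-! ### Valuations: units go to units, the generator goes to `p · (unit)` -/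

omit [Fact p.Prime] in
/-- A morphism of `D₀` preserves and reflects "valuation `= 1`" (it is valuative). [cite: MochizukiFrdII2008, Ex 1.1 (i) p.7] -/
theorem valuation_alg_eq_one_iff {X Y : PadicFld.{u} p} (f : X ⟶ Y) (y : Y.K) :
    valuation X.K (f.alg y) = 1 ↔ valuation Y.K y = 1 := by
  rw [le_antisymm_iff, le_antisymm_iff, ← (valuation X.K).map_one, ← (valuation Y.K).map_one,
    ← Valuation.Compatible.vle_iff_le, ← Valuation.Compatible.vle_iff_le, ← Valuation.Compatible.vle_iff_le,
    ← Valuation.Compatible.vle_iff_le, ← f.alg.map_one, f.isValHom, f.isValHom]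

include η hdeg in
/-- **Units go to units, and only units do**: the reading of `w ∈ O^▷(X_k)` has valuation `1` iff the rational function of
`w` does (abc-iut-L5-t16's `resK_unit_map_mem_unitSubgroup_iff`, then valuative field maps and `ε`).
[cite: MochizukiFrdII2008, Thm 1.2 (i) p.9] -/
theorem valuation_reading_eq_one_iff [ΨBase.Faithful]
    (hεv : ∀ (A : CosetCat P) (y : Q.fld A), valuation d.Ω (ε A y) = 1 ↔ valuation (Q.fld A) y = 1)
    (k : ℕ) (c : Algebra.GrothendieckGroup (Q.Φ.obj (op (cQ (N k)))))
    {w : (⟨cQ (N k), c⟩ : Q.frobenioid) ⟶ ⟨cQ (N k), c⟩}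
    (hw : w ∈ PreFrobenioid.endSubmonoid Q.structureFunctor (⟨cQ (N k), c⟩ : Q.frobenioid)) :
    valuation d.Ω (ε (cQ (N₂ k)) ((Q.base.map (j k ≫ e ⟨cQ (N k), c⟩)).alg
        ((Q.resK _ (ModelFrobenioid.unit (Ψ.functor.map w)) : (Q.fld _)ˣ) : Q.fld _))) = 1 ↔
      valuation d.Ω (ε (cQ (N k)) ((Q.resK _ (ModelFrobenioid.unit w) : (Q.fld (cQ (N k)))ˣ) : Q.fld (cQ (N k)))) = 1 := by
  rw [hεv, hεv, valuation_alg_eq_one_iff, ← mem_unitSubgroup_iff, ← mem_unitSubgroup_iff]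
  exact Q.resK_unit_map_mem_unitSubgroup_iff Ψ ΨBase η hdeg hw

include η hdeg in
/-- **The generator goes to `p · (unit)`**: if `t ∈ O^▷(X_k)` has rational function `p`, its reading has the valuation of
`p` — Div transport ([FrdI] Cor. 4.11 (iv)) under (INT) and the ramification clause `hram`, abc-iut-L5-t16's
`resK_unit_map_div_primeUnit_mem`. [cite: MochizukiFrdI2008, Cor. 4.11 (iv) p.92] -/
theorem valuation_reading_of_resK_eq_primeUnit [ΨBase.Faithful] (hD : IsOfFSMType (CosetCat P)) (hsl : IsSlim (CosetCat P))
    (hint : ∀ (A : CosetCat P) (a : OrdInt (Q.fld A)), ∃ x : Q.Φ.obj (op A), Q.ιHom A x = Realification.of _ a)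
    (hram : ∀ X : Q.frobenioid, ∃ ι : OrdInt (Q.fld X.base) ≃* OrdInt (Q.fld (Ψ.functor.obj X).base),
      ι (Associates.mk ⟨((p : ℕ) : Q.fld X.base), (Q.base.obj X.base).p_mem⟩) =
        Associates.mk ⟨((p : ℕ) : Q.fld (Ψ.functor.obj X).base), (Q.base.obj (Ψ.functor.obj X).base).p_mem⟩)
    (hεv : ∀ (A : CosetCat P) (y : Q.fld A), valuation d.Ω (ε A y) = 1 ↔ valuation (Q.fld A) y = 1)
    (k : ℕ) (c : Algebra.GrothendieckGroup (Q.Φ.obj (op (cQ (N k)))))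
    {t : (⟨cQ (N k), c⟩ : Q.frobenioid) ⟶ ⟨cQ (N k), c⟩}
    (ht : t ∈ PreFrobenioid.endSubmonoid Q.structureFunctor (⟨cQ (N k), c⟩ : Q.frobenioid))
    (hpt : Q.resK _ (ModelFrobenioid.unit t) = Q.primeUnit (cQ (N k))) :
    valuation d.Ω (ε (cQ (N₂ k)) ((Q.base.map (j k ≫ e ⟨cQ (N k), c⟩)).alg
        ((Q.resK _ (ModelFrobenioid.unit (Ψ.functor.map t)) : (Q.fld _)ˣ) : Q.fld _))) =
      valuation d.Ω ((p : ℕ) : d.Ω) := by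
  have hp : Q.resK _ (ModelFrobenioid.unit t) * (Q.primeUnit (cQ (N k)))⁻¹ ∈ unitSubgroup (Q.fld (cQ (N k))) := by
    rw [hpt, mul_inv_cancel]
    exact Subgroup.one_mem _
  have hu := Q.resK_unit_map_div_primeUnit_mem hD hsl Ψ hint hram ΨBase η hdeg ht hp
  set u := Q.resK _ (ModelFrobenioid.unit (Ψ.functor.map t)) * (Q.primeUnit (Ψ.functor.obj ⟨cQ (N k), c⟩).base)⁻¹ with hu_def
  have hfac : Q.resK _ (ModelFrobenioid.unit (Ψ.functor.map t)) = Q.primeUnit (Ψ.functor.obj ⟨cQ (N k), c⟩).base * u := by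
    rw [hu_def, ← mul_assoc, mul_comm (Q.primeUnit _) (Q.resK _ _), mul_assoc, mul_inv_cancel, mul_one]
  have hu1 : valuation d.Ω (ε (cQ (N₂ k)) ((Q.base.map (j k ≫ e ⟨cQ (N k), c⟩)).alg (u : Q.fld _))) = 1 := by
    rw [hεv, valuation_alg_eq_one_iff, ← mem_unitSubgroup_iff]
    exact hu
  rw [hfac, Units.val_mul, map_mul, map_mul, Valuation.map_mul, hu1, mul_one, Datum.coe_primeUnit, map_natCast,
    map_natCast]


/-! ### Levels, field elements and classes along the tower of an object `X` -/

include hN in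
/-- **Every element of `Ω` is fixed by a deep enough level of the tower** (its stabiliser in `G_v` is open, `aug` is
continuous, the tower is cofinal). [cite: Mochizuki2012, I Ex 3.3 (i) p.78] -/
theorem exists_level (hc : Continuous aug) (hNb : ∀ U ∈ 𝓝 (1 : P), ∃ k, (N k : Set P) ⊆ U) (k₀ : ℕ)
    (x : intNonzero d.Ω) : ∃ k, k₀ ≤ k ∧ ∀ u ∈ N k, (aug u) (x : d.Ω) = x := by
  obtain ⟨V, hV⟩ := d.exists_open_forall_galAct_eq x
  have hU : ((V.sg.toSubgroup.comap aug : Subgroup P) : Set P) ∈ 𝓝 (1 : P) :=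
    (V.sg.isOpen.preimage hc).mem_nhds (by simp)
  obtain ⟨k, hk⟩ := hNb _ hU
  refine ⟨max k k₀, le_max_right _ _, fun u hu => ?_⟩
  have hu' : u ∈ ((V.sg.toSubgroup.comap aug : Subgroup P) : Set P) := hk (hN (le_max_left k k₀) hu)
  exact (d.galAct_eq_iff (aug u) x).mp (hV (aug u) hu')

/-- **Nonzero integers of `Ω` fixed by `aug(N_k)` come from nonzero integers of the field of `Π_v/N_k`** (the field
inclusion `ε` detects the valuation). [cite: MochizukiFrdII2008, Ex 1.1 (i) p.7] -/
theorem exists_intNonzero_fld (hεle : ∀ (A : CosetCat P) (a b : Q.fld A), ε A a ≤ᵥ ε A b ↔ a ≤ᵥ b)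
    (hεs : ∀ (A : CosetCat P) (x : d.Ω), (∀ u ∈ A.sg, (aug u) x = x) → ∃ y : Q.fld A, ε A y = x)
    (A : CosetCat P) (x : intNonzero d.Ω) (hx : ∀ u ∈ A.sg, (aug u) (x : d.Ω) = x) :
    ∃ y : intNonzero (Q.fld A), ε A (y : Q.fld A) = x := by
  obtain ⟨y, hy⟩ := hεs A x hx
  refine ⟨⟨y, ?_, fun h0 => x.2.2 (by rw [← hy, h0, map_zero])⟩, hy⟩
  rw [← (valuation (Q.fld A)).map_one, ← Valuation.Compatible.vle_iff_le, ← hεle, hy, map_one,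
    Valuation.Compatible.vle_iff_le (v := valuation d.Ω), map_one]
  exact x.2.1

include hN in
/-- The projections of the tower of `X` compose: `π_{k'} = cproj ≫ π_k`, so the classes `π_k^* cls X` are compatible.
[cite: MochizukiFrdI2008, Thm. 5.2(i) p.100] -/
theorem pullGp_proj_eq (X : Q.frobenioid) {k₀ k k' : ℕ} (hk : k₀ ≤ k) (hkk' : k ≤ k')
    (hk₀ : (N k₀).toOpenSubgroup ≤ X.base.sg) :
    pullGp Q.Φ (CosetCat.homMk ((1 : P) : X.base.carrier) (proj_wd X.base (N k') fun _ hu => hk₀ (hN (hk.trans hkk') hu))) X.cls =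
      pullGp Q.Φ (cproj (hN hkk'))
        (pullGp Q.Φ (CosetCat.homMk ((1 : P) : X.base.carrier) (proj_wd X.base (N k) fun _ hu => hk₀ (hN hk hu))) X.cls) := by
  have hπ : cproj (hN hkk') ≫ CosetCat.homMk ((1 : P) : X.base.carrier) (proj_wd X.base (N k) fun _ hu => hk₀ (hN hk hu)) =
      CosetCat.homMk ((1 : P) : X.base.carrier) (proj_wd X.base (N k') fun _ hu => hk₀ (hN (hk.trans hkk') hu)) :=
    CosetCat.hom_ext (by rw [CosetCat.pt_comp, pt_cproj, CosetCat.homMk_toFun_coe, one_smul, CosetCat.pt_homMk])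
  rw [← hπ, pullGp_comp]

/-! ### The glued unit transport `C₁ : O^▷_{K̄_v} → O^▷_{K̄_v}` -/

include hN η hdeg he hεi hε hj hφ in
/-- **The unit transport of `Ψ` on `O^▷_{K̄_v}`.**  For an object `X` of the REAL `C_v` (and a level `k₀` of the tower below
`Base X`), gluing the level-`k` readings of the unit transport of `Ψ` (prequel) gives ONE map `C₁ : O^▷_{K̄_v} → O^▷_{K̄_v}`
— multiplicative, injective, `φ`-SEMILINEAR for the `Π_v`-action through `aug`, carrying units to units and only units,
with `v(C₁(p)) = v(p)` ([FrdI] Cor. 4.11 (iv) Div transport) — such that for every `w ∈ O^▷(X)`: the rational function of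
`Ψ w` is `p^m` iff `C₁` of the rational function of `w` (read in `Ω`) is `p^m`.  ([FrdII] Thm. 2.4 (ii): "by varying the
objects … `Ψ` induces … `K̄₁^× ⥲ K̄₂^×`", here on `O^▷` and for `Ψ` a SELF-equivalence.)
[cite: MochizukiFrdII2008, Thm 2.4 (ii) p.21] -/
theorem exists_unitTransport [ΨBase.Faithful] (hc : Continuous aug) (hNb : ∀ U ∈ 𝓝 (1 : P), ∃ k, (N k : Set P) ⊆ U)
    (hεle : ∀ (A : CosetCat P) (a b : Q.fld A), ε A a ≤ᵥ ε A b ↔ a ≤ᵥ b)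
    (hεs : ∀ (A : CosetCat P) (x : d.Ω), (∀ u ∈ A.sg, (aug u) x = x) → ∃ y : Q.fld A, ε A y = x)
    (hint : ∀ (A : CosetCat P) (a : OrdInt (Q.fld A)), ∃ x : Q.Φ.obj (op A), Q.ιHom A x = Realification.of _ a)
    (hD : IsOfFSMType (CosetCat P)) (hsl : IsSlim (CosetCat P))
    (hram : ∀ X : Q.frobenioid, ∃ ι : OrdInt (Q.fld X.base) ≃* OrdInt (Q.fld (Ψ.functor.obj X).base),
      ι (Associates.mk ⟨((p : ℕ) : Q.fld X.base), (Q.base.obj X.base).p_mem⟩) =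
        Associates.mk ⟨((p : ℕ) : Q.fld (Ψ.functor.obj X).base), (Q.base.obj (Ψ.functor.obj X).base).p_mem⟩)
    (X : Q.frobenioid) (k₀ : ℕ) (hk₀ : (N k₀).toOpenSubgroup ≤ X.base.sg) :
    ∃ C : ↥(intNonzero d.Ω) →* ↥(intNonzero d.Ω),
      Injective C ∧
      (∀ (g : P) (x : intNonzero d.Ω), ((C (d.galAct (aug g) x) : intNonzero d.Ω) : d.Ω) = (aug (φ g)) (C x)) ∧
      (∀ x : intNonzero d.Ω, valuation d.Ω ((C x : intNonzero d.Ω) : d.Ω) = 1 ↔ valuation d.Ω (x : d.Ω) = 1) ∧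
      (∀ x : intNonzero d.Ω, (x : d.Ω) = (p : ℕ) → valuation d.Ω ((C x : intNonzero d.Ω) : d.Ω) = valuation d.Ω ((p : ℕ) : d.Ω)) ∧
      ∀ (w : X ⟶ X), w ∈ PreFrobenioid.endSubmonoid Q.structureFunctor X → ∀ (x : intNonzero d.Ω),
        (x : d.Ω) = ε X.base ((Q.resK _ (ModelFrobenioid.unit w) : (Q.fld X.base)ˣ) : Q.fld X.base) → ∀ m : ℕ,
          (Q.resK _ (ModelFrobenioid.unit (Ψ.functor.map w)) = Q.primeUnit (Ψ.functor.obj X).base ^ m ↔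
            ((C x : intNonzero d.Ω) : d.Ω) = ((p : ℕ) : d.Ω) ^ m) := by
  classical
  have hεv : ∀ (A : CosetCat P) (y : Q.fld A), valuation d.Ω (ε A y) = 1 ↔ valuation (Q.fld A) y = 1 := fun A y => by
    rw [le_antisymm_iff, le_antisymm_iff, ← (valuation d.Ω).map_one, ← (valuation (Q.fld A)).map_one,
      ← Valuation.Compatible.vle_iff_le, ← Valuation.Compatible.vle_iff_le, ← Valuation.Compatible.vle_iff_le,
      ← Valuation.Compatible.vle_iff_le, ← (ε A).map_one, hεle, hεle]
  -- the tower of `X`: projections, classes, objects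
  let π : ∀ k, k₀ ≤ k → (cQ (N k) ⟶ X.base) := fun k hk =>
    CosetCat.homMk ((1 : P) : X.base.carrier) (proj_wd X.base (N k) fun _ hu => hk₀ (hN hk hu))
  let c : ∀ k, k₀ ≤ k → Algebra.GrothendieckGroup (Q.Φ.obj (op (cQ (N k)))) := fun k hk => pullGp Q.Φ (π k hk) X.cls
  -- the reading at level `k`
  let R : ∀ k (hk : k₀ ≤ k), ((⟨cQ (N k), c k hk⟩ : Q.frobenioid) ⟶ ⟨cQ (N k), c k hk⟩) → d.Ω := fun k hk w =>
    ε (cQ (N₂ k)) ((Q.base.map (j k ≫ e ⟨cQ (N k), c k hk⟩)).alg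
      ((Q.resK _ (ModelFrobenioid.unit (Ψ.functor.map w)) : (Q.fld _)ˣ) : Q.fld _))
  -- readings only depend on the rational function in `Ω`
  have hRwd : ∀ {k₁ k₂ : ℕ} (hk₁ : k₀ ≤ k₁) (hk₂ : k₀ ≤ k₂)
      {w₁ : (⟨cQ (N k₁), c k₁ hk₁⟩ : Q.frobenioid) ⟶ ⟨cQ (N k₁), c k₁ hk₁⟩}
      (hw₁ : w₁ ∈ PreFrobenioid.endSubmonoid Q.structureFunctor (⟨cQ (N k₁), c k₁ hk₁⟩ : Q.frobenioid))
      {w₂ : (⟨cQ (N k₂), c k₂ hk₂⟩ : Q.frobenioid) ⟶ ⟨cQ (N k₂), c k₂ hk₂⟩}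
      (hw₂ : w₂ ∈ PreFrobenioid.endSubmonoid Q.structureFunctor (⟨cQ (N k₂), c k₂ hk₂⟩ : Q.frobenioid)),
      ε (cQ (N k₁)) ((Q.resK _ (ModelFrobenioid.unit w₁) : (Q.fld (cQ (N k₁)))ˣ) : Q.fld (cQ (N k₁))) =
        ε (cQ (N k₂)) ((Q.resK _ (ModelFrobenioid.unit w₂) : (Q.fld (cQ (N k₂)))ˣ) : Q.fld (cQ (N k₂))) →
      R k₁ hk₁ w₁ = R k₂ hk₂ w₂ := by
    intro k₁ k₂ hk₁ hk₂ w₁ hw₁ w₂ hw₂ h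
    exact reading_eq_of_eps_eq d aug Q ε hεi hε Ψ ΨBase η hdeg e he N N₂ hN hN₂ j hj (le_max_left k₁ k₂) (le_max_right k₁ k₂)
      (c k₁ hk₁) (c k₂ hk₂) (c (max k₁ k₂) (hk₁.trans (le_max_left k₁ k₂)))
      (pullGp_proj_eq Q N hN X hk₁ (le_max_left k₁ k₂) hk₀) (pullGp_proj_eq Q N hN X hk₂ (le_max_right k₁ k₂) hk₀) hw₁ hw₂ h
  -- levels, field elements, elements of `O^▷`
  have hlev := fun x : intNonzero d.Ω => exists_level d aug N hN hc hNb k₀ x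
  choose lvl hlvl₀ hlvl using hlev
  have hfld := fun x : intNonzero d.Ω => exists_intNonzero_fld d aug Q ε hεle hεs (cQ (N (lvl x))) x (hlvl x)
  choose y hy using hfld
  have hO := fun x : intNonzero d.Ω =>
    Q.exists_mem_endSubmonoid_resK_unit_eq hint (⟨cQ (N (lvl x)), c (lvl x) (hlvl₀ x)⟩ : Q.frobenioid) (y x)
  choose w hw hwy using hO
  have hεw : ∀ x : intNonzero d.Ω,
      ε (cQ (N (lvl x))) ((Q.resK _ (ModelFrobenioid.unit (w x)) : (Q.fld (cQ (N (lvl x))))ˣ) : Q.fld (cQ (N (lvl x)))) = x :=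
    fun x => by rw [hwy, coe_intNonzeroToUnits]; exact hy x
  -- the values are nonzero integers
  have hval : ∀ x : intNonzero d.Ω, R (lvl x) (hlvl₀ x) (w x) ∈ intNonzero d.Ω := by
    intro x
    have hΨw := (Q.map_mem_endSubmonoid_iff Ψ ΨBase η hdeg (w x)).mpr (hw x)
    refine ⟨?_, ?_⟩
    · rw [← (valuation d.Ω).map_one, ← Valuation.Compatible.vle_iff_le, ← (ε (cQ (N₂ (lvl x)))).map_one, hεle,
        ← (Q.base.map _).alg.map_one, (Q.base.map _).isValHom,
        Valuation.Compatible.vle_iff_le (v := valuation (Q.fld _)), map_one]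
      exact Q.valuation_resK_le_one_of_divB_eq_of _ _ _ (Q.of_div_eq_divB_unit hΨw).symm
    · exact (map_ne_zero_iff _ (hεi _)).mpr ((map_ne_zero_iff _ (RingHom.injective _)).mpr (Units.ne_zero _))
  -- every reading over `x` is `R (w x)`
  have key : ∀ (x : intNonzero d.Ω) {k : ℕ} (hk : k₀ ≤ k) {w' : (⟨cQ (N k), c k hk⟩ : Q.frobenioid) ⟶ ⟨cQ (N k), c k hk⟩}
      (hw' : w' ∈ PreFrobenioid.endSubmonoid Q.structureFunctor (⟨cQ (N k), c k hk⟩ : Q.frobenioid)),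
      ε (cQ (N k)) ((Q.resK _ (ModelFrobenioid.unit w') : (Q.fld (cQ (N k)))ˣ) : Q.fld (cQ (N k))) = x →
      R k hk w' = R (lvl x) (hlvl₀ x) (w x) := fun x k hk w' hw' h =>
    hRwd hk (hlvl₀ x) hw' (hw x) (h.trans (hεw x).symm)
  -- elements of `O^▷` over a given `x` at a given admissible level
  have hO' : ∀ (x : intNonzero d.Ω) {k : ℕ} (hk : k₀ ≤ k), (∀ u ∈ N k, (aug u) (x : d.Ω) = x) →
      ∃ w' : (⟨cQ (N k), c k hk⟩ : Q.frobenioid) ⟶ ⟨cQ (N k), c k hk⟩,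
        w' ∈ PreFrobenioid.endSubmonoid Q.structureFunctor (⟨cQ (N k), c k hk⟩ : Q.frobenioid) ∧
        ε (cQ (N k)) ((Q.resK _ (ModelFrobenioid.unit w') : (Q.fld (cQ (N k)))ˣ) : Q.fld (cQ (N k))) = x := by
    intro x k hk hx
    obtain ⟨y', hy'⟩ := exists_intNonzero_fld d aug Q ε hεle hεs (cQ (N k)) x hx
    obtain ⟨w', hw', hwy'⟩ := Q.exists_mem_endSubmonoid_resK_unit_eq hint (⟨cQ (N k), c k hk⟩ : Q.frobenioid) y'
    exact ⟨w', hw', by rw [hwy', coe_intNonzeroToUnits]; exact hy'⟩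
  -- deeper levels fix more
  have hfix_mono : ∀ (x : intNonzero d.Ω) {k : ℕ}, lvl x ≤ k → ∀ u ∈ N k, (aug u) (x : d.Ω) = x :=
    fun x k hk u hu => hlvl x u (hN hk hu)
  refine ⟨{ toFun := fun x => ⟨R (lvl x) (hlvl₀ x) (w x), hval x⟩, map_one' := ?_, map_mul' := ?_ }, ?_, ?_, ?_, ?_, ?_⟩
  · -- `C 1 = 1`: the identity of `X_k` lies over `1`
    apply Subtype.ext
    have h1 : ε (cQ (N (lvl 1))) ((Q.resK _ (ModelFrobenioid.unit
        (𝟙 (⟨cQ (N (lvl 1)), c (lvl 1) (hlvl₀ 1)⟩ : Q.frobenioid))) : (Q.fld (cQ (N (lvl 1))))ˣ) : Q.fld (cQ (N (lvl 1)))) =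
        ((1 : intNonzero d.Ω) : d.Ω) := by
      rw [ModelFrobenioid.unit_id, map_one, Units.val_one, map_one, OneMemClass.coe_one]
    have hone : (1 : End (⟨cQ (N (lvl 1)), c (lvl 1) (hlvl₀ 1)⟩ : Q.frobenioid)) ∈
        PreFrobenioid.endSubmonoid Q.structureFunctor (⟨cQ (N (lvl 1)), c (lvl 1) (hlvl₀ 1)⟩ : Q.frobenioid) :=
      Submonoid.one_mem _
    have h2 := key 1 (hlvl₀ 1) hone h1
    change R (lvl 1) (hlvl₀ 1) (w 1) = ((1 : intNonzero d.Ω) : d.Ω)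
    rw [← h2]
    dsimp only [R]
    simp only [CategoryTheory.End.one_def, CategoryTheory.Functor.map_id, ModelFrobenioid.unit_id, map_one, Units.val_one,
      OneMemClass.coe_one]
  · -- multiplicativity: move both factors to a common level
    intro x₁ x₂
    apply Subtype.ext
    change R (lvl (x₁ * x₂)) (hlvl₀ (x₁ * x₂)) (w (x₁ * x₂)) = R (lvl x₁) (hlvl₀ x₁) (w x₁) * R (lvl x₂) (hlvl₀ x₂) (w x₂)
    let k := max (lvl x₁) (lvl x₂)
    have hk : k₀ ≤ k := (hlvl₀ x₁).trans (le_max_left _ _)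
    obtain ⟨w₁, hw₁, hε₁⟩ := hO' x₁ hk (hfix_mono x₁ (le_max_left _ _))
    obtain ⟨w₂, hw₂, hε₂⟩ := hO' x₂ hk (hfix_mono x₂ (le_max_right _ _))
    have hm : (End.of w₁ * End.of w₂) ∈ PreFrobenioid.endSubmonoid Q.structureFunctor (⟨cQ (N k), c k hk⟩ : Q.frobenioid) :=
      Submonoid.mul_mem _ hw₁ hw₂
    have h12 : ε (cQ (N k)) ((Q.resK _ (ModelFrobenioid.unit (w₂ ≫ w₁)) : (Q.fld (cQ (N k)))ˣ) : Q.fld (cQ (N k))) =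
        ((x₁ * x₂ : intNonzero d.Ω) : d.Ω) := by
      rw [Q.unit_comp_of_mem hw₁ hw₂, map_mul, Units.val_mul, map_mul, hε₁, hε₂]
      rfl
    rw [← key (x₁ * x₂) hk hm h12, ← key x₁ hk hw₁ hε₁, ← key x₂ hk hw₂ hε₂]
    exact reading_mul d Q ε Ψ ΨBase η hdeg e N N₂ j k (c k hk) hw₁ hw₂
  · -- injectivity
    intro x₁ x₂ h
    have h' : R (lvl x₁) (hlvl₀ x₁) (w x₁) = R (lvl x₂) (hlvl₀ x₂) (w x₂) := congrArg Subtype.val h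
    let k := max (lvl x₁) (lvl x₂)
    have hk : k₀ ≤ k := (hlvl₀ x₁).trans (le_max_left _ _)
    obtain ⟨w₁, hw₁, hε₁⟩ := hO' x₁ hk (hfix_mono x₁ (le_max_left _ _))
    obtain ⟨w₂, hw₂, hε₂⟩ := hO' x₂ hk (hfix_mono x₂ (le_max_right _ _))
    rw [← key x₁ hk hw₁ hε₁, ← key x₂ hk hw₂ hε₂] at h'
    have h12 : w₁ = w₂ := eq_of_reading_eq d Q ε hεi Ψ ΨBase η hdeg e N N₂ j k (c k hk) hw₁ hw₂ h'
    apply Subtype.ext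
    rw [← hε₁, ← hε₂, h12]
  · -- `φ`-semilinearity
    intro g x
    change R (lvl (d.galAct (aug g) x)) (hlvl₀ _) (w _) = (aug (φ g)) (R (lvl x) (hlvl₀ x) (w x))
    -- both at the level of `x` (the translate is fixed there too: `N_k` is normal)
    have hgx : ∀ u ∈ N (lvl x), (aug u) ((d.galAct (aug g) x : intNonzero d.Ω) : d.Ω) = d.galAct (aug g) x := by
      intro u hu
      rw [GaloisValDatum.coe_galAct_apply, ← AlgEquiv.mul_apply, ← map_mul,
        show u * g = g * (g⁻¹ * u * g) by group, map_mul, AlgEquiv.mul_apply,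
        hlvl x _ ((N (lvl x)).isNormal'.conj_mem' u hu g)]
    obtain ⟨w', hw', hε'⟩ := hO' (d.galAct (aug g) x) (hlvl₀ x) hgx
    rw [← key (d.galAct (aug g) x) (hlvl₀ x) hw' hε']
    refine reading_smul d aug Q ε hεi hε Ψ ΨBase η hdeg e he N N₂ j φ hφ (lvl x) (c (lvl x) (hlvl₀ x)) g (hw x) hw' ?_
    rw [hε', hεw, GaloisValDatum.coe_galAct_apply]
  · -- units go to units and only units
    intro x
    change valuation d.Ω (R (lvl x) (hlvl₀ x) (w x)) = 1 ↔ _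
    rw [valuation_reading_eq_one_iff d Q ε Ψ ΨBase η hdeg e N N₂ j hεv (lvl x) (c (lvl x) (hlvl₀ x)) (hw x), hεw]
  · -- `v(C p) = v(p)`
    intro x hx
    change valuation d.Ω (R (lvl x) (hlvl₀ x) (w x)) = _
    refine valuation_reading_of_resK_eq_primeUnit d Q ε Ψ ΨBase η hdeg e N N₂ j hD hsl hint hram hεv (lvl x)
      (c (lvl x) (hlvl₀ x)) (hw x) (Units.ext (hεi _ ?_))
    rw [hεw, hx, Datum.coe_primeUnit, map_natCast]
  · -- the link with `O^▷(X)`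
    intro v hv x hx m
    have hπ1 : CosetCat.pt (π k₀ le_rfl) = ((1 : P) : X.base.carrier) :=
      CosetCat.pt_homMk _ (proj_wd X.base (N k₀) fun _ hu => hk₀ (hN le_rfl hu))
    obtain ⟨vk, hvk, hsq, hεvk⟩ := exists_restrict_of_pt_one d aug Q ε hε
      (ModelFrobenioid.mkHom (⟨cQ (N k₀), c k₀ le_rfl⟩ : Q.frobenioid) X 1 (π k₀ le_rfl) 1 1
        (lift_rel Q X (π k₀ le_rfl) (c k₀ le_rfl) rfl))
      (isLinear_mkHom_one Q _ _ _ _) hπ1 hv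
    change _ ↔ R (lvl x) (hlvl₀ x) (w x) = _
    rw [← key x le_rfl hvk (hεvk.trans hx.symm)]
    exact resK_unit_map_eq_pow_iff d Q ε Ψ ΨBase η hdeg e N N₂ j X k₀ hk₀ hv hvk hsq m

end Tower


end UnitTransport

end GoodLocalFrobenioid

end Literature.IUT.HodgeTheaters

end
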